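/-
Copyright (c) 2026 the pub-hodgecm-mathlib formalisation cell (harness21).  Prover seat hodgecm-mathlib-K2E1-p12 (g5), Track B ∕ K2-LIT, h413 = `stmt-HodgeConjecture-24833`,
R90-TF section S8 «ContSpec-n½», (ADM) road of `hDISC`, step (β) FILE β1 (S8 dealer R90-CS-plan (g3), S8-R193; census `R90/S8/CENSUS-beta-KFiniteExchange.K2E1-p12-g5.md`): GENERIC
linear algebra — a `K`-module carrying a `K`-invariant positive-definite sesquilinear form is completely reducible; `K`-maps into a quotient lift; «the `τ`-part of the image is the image of
the `τ`-part».
-/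
import Literature.NumberTheory.Automorphic.UnitaryIsotypicProjection   -- ★ `Representation.homRangeSum`, `apply_mem_homRangeSum` (+ Mathlib `Representation.IntertwiningMap`)
import HarnessLib

/-!
# S8 (ADM) road, step (β) FILE β1 — `R90S8KModuleInvariantFormComplementU3`: INVARIANT POSITIVE FORMS GIVE STABLE COMPLEMENTS AND LIFTS OF `K`-MAPS

Track B ∕ R90-TF, crux h413 = `stmt-HodgeConjecture-24833`, route `HCCMUnconditional`; cell `hodgecm-mathlib`, S8 «ContSpec-n½», the (ADM) road of the `hDISC` letter of (R)′ (★ p863816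
`hDISC_of_inv_of_admissible`; R90-C133-p02's census `CENSUS-ADM-payer`, step (β) dealt to this seat S8-R193).  THEOREMS ONLY (no `def`∕`instance`∕`notation`, no named-fact hypothesis,
no `sorry`, default heartbeats); lane `--supports … --as helper`; CLOSES NO SOCKET; GENERIC (any group `K`, any complex `K`-module), Mathlib + ★ `UnitaryIsotypicProjection` only.

THE MATHEMATICS ([BrockerTomDieck1985] II (1.7), (1.9); [WallachRRG1] §1.4.6–§1.4.7; [Serre1977] §1.3 Thm. 1).  The τ-EXCHANGE step of (β) («the `τ`-part of `Res(S_φ)` lies in `Res` of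
the `τ`-part of `S_φ`») is a LIFT of `K`-maps through a surjective `K`-map out of the finite-dimensional `K_max`-module `S_φ` of residue data — i.e. COMPLETE REDUCIBILITY of `S_φ`, which
the tree does not have for abstract modules of a compact group (finite-group Maschke `Literature/Algebra/GroupRings/Maschke*`, unitary-Hilbert `tauPart` machinery only) and which is
load-bearing (false for non-semisimple modules).  FILE β2 unitarises `S_φ` by restriction to `K_max`; THIS FILE is the generic algebra it then invokes:
* §1 **`exists_stable_compl_of_invariant_form`** — `ρ : Representation ℂ K V`, a sesquilinear form `B : V →ₗ⋆[ℂ] V →ₗ[ℂ] ℂ` that is `ρ`-INVARIANT (`B (ρ k a) (ρ k b) = B a b`) and DEFINITE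
  on a finite-dimensional stable `S` (`B a a = 0 → a = 0` on `S`), a stable `U ≤ S` ⊢ a stable `C ≤ S` with `U ⊓ C = ⊥`, `U ⊔ C = S` (the `B`-orthogonal of `U` inside `S`: stable
  because `B u (ρ k v) = B (ρ k⁻¹ u) v`; disjoint by definiteness; spanning by rank–nullity against a basis of `U`).
* §2 **`exists_intertwiningMap_lift`** — with `(ρ, B, S)` as in §1, a `K`-module `(N, σ)`, a linear `P : V → N` equivariant ON `S`, and a `K`-map `u : τ → σ` with values in `P(S)` ⊢ a
  `K`-map `ũ : τ → ρ` with values in `S` and `P ∘ ũ = u` (§1 at `U := S ⊓ ker P`; `P|_C : C ≃ P(S)`).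
* §3 **`mem_map_homRangeSum_of_intertwiningMap`** — hence every value `u w` of such a `u` is `P v` for some `v ∈ S ∩ (τ-part of ρ)` («`τ`-part of the image ⊆ image of the `τ`-part»,
  the converse inclusion to ★ (3′) L5 `map_chiSectionSpacePairKType_le_homRangeSum`).
HONEST LABEL: HC_CM is proved only modulo the 7 printed citations (2 remaining named inputs: hLiu418 = `stmt-HodgeConjecture-24832`, h413 = `stmt-HodgeConjecture-24833`) until
rung 0 closes; REL ≠ ★ ≠ BUILT; generic algebra, asserts no named fact, closes no socket; count-neutral.

## References
* [BrockerTomDieck1985] T. Bröcker, T. tom Dieck, *Representations of Compact Lie Groups*, GTM 98 (1985), II (1.7) (invariant inner products), II (1.9) (complete reducibility).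
* [WallachRRG1] N. R. Wallach, *Real Reductive Groups I* (1988), §1.4.6–§1.4.7 (`V(γ)`, Schur).
* [Serre1977] J.-P. Serre, *Linear Representations of Finite Groups*, GTM 42 (1977), §1.3 Thm. 1 (complements via an invariant Hermitian form).
-/

set_option autoImplicit false
set_option linter.dupNamespace false  -- the mandated namespace `…HodgeConjecture.HodgeConjecture.R90.S8` (LEAD #1 L1) repeats the summit's segment

noncomputable section

open scoped ComplexConjugate

namespace Summit.HodgeConjecture.HodgeConjecture.R90.S8

variable {K : Type*} [Group K] {V : Type*} [AddCommGroup V] [Module ℂ V]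

/-! ## §1 An invariant definite form gives stable complements -/

/-- **§1. STABLE COMPLEMENTS FROM AN INVARIANT POSITIVE FORM** ([Serre1977] §1.3 Thm. 1 ∕ [BrockerTomDieck1985] II (1.9), for ANY group): `ρ` a complex `K`-module, `B` a sesquilinear form
(conjugate-linear in the first slot) with `B (ρ k a) (ρ k b) = B a b`, DEFINITE on the finite-dimensional `ρ`-stable subspace `S`; then every `ρ`-stable `U ≤ S` has a `ρ`-stable complement
`C` inside `S` — the `B`-orthogonal `C := S ⊓ {v | ∀ u ∈ U, B u v = 0}`: stable since `B u (ρ k v) = B (ρ k⁻¹ u) v`, `U ⊓ C = ⊥` by definiteness, `U ⊔ C = S` by rank–nullity of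
`v ↦ (B bᵢ v)ᵢ` for a basis `(bᵢ)` of `U`. [cite: Serre1977, §1.3 Thm. 1] [cite: BrockerTomDieck1985, II (1.9)] -/
theorem exists_stable_compl_of_invariant_form (ρ : Representation ℂ K V)
    (B : V →ₗ⋆[ℂ] V →ₗ[ℂ] ℂ) (hBinv : ∀ (k : K) (a b : V), B (ρ k a) (ρ k b) = B a b)
    {S : Submodule ℂ V} [FiniteDimensional ℂ S] (hS : ∀ k, ∀ v ∈ S, ρ k v ∈ S) (hBdef : ∀ a ∈ S, B a a = 0 → a = 0)
    {U : Submodule ℂ V} (hUS : U ≤ S) (hU : ∀ k, ∀ v ∈ U, ρ k v ∈ U) :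
    ∃ C : Submodule ℂ V, C ≤ S ∧ (∀ k, ∀ v ∈ C, ρ k v ∈ C) ∧ U ⊓ C = ⊥ ∧ U ⊔ C = S := by
  classical
  haveI : FiniteDimensional ℂ U := Submodule.finiteDimensional_of_le hUS
  -- the `B`-orthogonal of `U` inside `S`
  set C : Submodule ℂ V := S ⊓ ⨅ u ∈ U, LinearMap.ker (B u) with hCdef
  have hCmem : ∀ v, v ∈ C ↔ v ∈ S ∧ ∀ u ∈ U, B u v = 0 := fun v => by
    simp only [hCdef, Submodule.mem_inf, Submodule.mem_iInf, LinearMap.mem_ker]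
  haveI : FiniteDimensional ℂ C := Submodule.finiteDimensional_of_le (inf_le_left : C ≤ S)
  have hdisj : U ⊓ C = ⊥ := by
    refine eq_bot_iff.2 fun v hv => (Submodule.mem_bot ℂ).2 (hBdef v (hUS hv.1) (((hCmem v).1 hv.2).2 v hv.1))
  refine ⟨C, inf_le_left, fun k v hv => ?_, hdisj, ?_⟩
  · -- stability
    rw [hCmem] at hv ⊢
    refine ⟨hS k v hv.1, fun u hu => ?_⟩
    have hρ : ρ k (ρ k⁻¹ u) = u := by
      rw [← Module.End.mul_apply, ← map_mul, mul_inv_cancel, map_one, Module.End.one_apply]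
    rw [← hρ, hBinv]
    exact hv.2 _ (hU k⁻¹ u hu)
  · -- spanning, by dimension count
    set b := Module.finBasis ℂ U with hb
    set Φ : S →ₗ[ℂ] (Fin (Module.finrank ℂ U) → ℂ) := LinearMap.pi fun i => (B ((b i : U) : V)).comp S.subtype with hΦ
    have hker : ∀ v : S, v ∈ LinearMap.ker Φ ↔ (v : V) ∈ C := by
      intro v
      rw [LinearMap.mem_ker, hCmem]
      constructor
      · intro h
        refine ⟨v.2, fun u hu => ?_⟩
        -- the conjugate-linear functional `u ↦ B u v` vanishes on the basis, hence on `U`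
        have hi : ∀ i, B ((b i : U) : V) (v : V) = 0 := fun i => by
          have := congrFun h i
          simpa only [hΦ, LinearMap.pi_apply, LinearMap.coe_comp, Function.comp_apply, Submodule.coe_subtype, Pi.zero_apply] using this
        have hL : (B.flip (v : V)).comp U.subtype = 0 := b.ext fun i => by
          rw [LinearMap.comp_apply, Submodule.coe_subtype, LinearMap.flip_apply, hi i, LinearMap.zero_apply]
        have := LinearMap.congr_fun hL ⟨u, hu⟩
        rwa [LinearMap.comp_apply, Submodule.coe_subtype, LinearMap.flip_apply, LinearMap.zero_apply] at this
      · intro hC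
        funext i
        simp only [hΦ, LinearMap.pi_apply, LinearMap.coe_comp, Function.comp_apply, Submodule.coe_subtype, Pi.zero_apply]
        exact hC.2 _ (b i).2
    have hmap : (LinearMap.ker Φ).map S.subtype = C := by
      ext v
      constructor
      · rintro ⟨w, hw, rfl⟩
        exact (hker w).1 hw
      · intro hv
        exact ⟨⟨v, (inf_le_left : C ≤ S) hv⟩, (hker _).2 hv, rfl⟩
    have h1 : Module.finrank ℂ (LinearMap.range Φ) + Module.finrank ℂ (LinearMap.ker Φ) = Module.finrank ℂ S := LinearMap.finrank_range_add_finrank_ker Φ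
    have h2 : Module.finrank ℂ (LinearMap.range Φ) ≤ Module.finrank ℂ U :=
      (Submodule.finrank_le _).trans (by rw [Module.finrank_fin_fun])
    have h3 : Module.finrank ℂ (LinearMap.ker Φ) = Module.finrank ℂ C := by
      rw [← hmap, Submodule.finrank_map_subtype_eq]
    have h4 := Submodule.finrank_sup_add_finrank_inf_eq U C
    rw [hdisj, finrank_bot, add_zero] at h4
    exact Submodule.eq_of_le_of_finrank_le (sup_le hUS inf_le_left) (by omega)

/-! ## §2 `K`-maps into a quotient lift -/

/-- **§2. LIFTING `K`-MAPS THROUGH A SURJECTIVE `K`-MAP** ([BrockerTomDieck1985] II (1.9) ∕ [WallachRRG1] §1.4.6): with `(ρ, B, S)` as in §1 (invariant form, definite on the finite-dimensional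
stable `S`), a `K`-module `(N, σ)`, a linear `P : V → N` that is `K`-equivariant ON `S`, and a `K`-map `u : τ → σ` taking values in `P(S)`: there is a `K`-map `ũ : τ → ρ` with values in `S`
and `P (ũ w) = u w` — §1 at `U := S ⊓ ker P` gives a stable complement `C`, and `P|_C : C ≃ P(S)` is a `K`-isomorphism through which `u` factors.
[cite: BrockerTomDieck1985, II (1.9)] [cite: WallachRRG1, §1.4.6] -/
theorem exists_intertwiningMap_lift (ρ : Representation ℂ K V)
    (B : V →ₗ⋆[ℂ] V →ₗ[ℂ] ℂ) (hBinv : ∀ (k : K) (a b : V), B (ρ k a) (ρ k b) = B a b)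
    {S : Submodule ℂ V} [FiniteDimensional ℂ S] (hS : ∀ k, ∀ v ∈ S, ρ k v ∈ S) (hBdef : ∀ a ∈ S, B a a = 0 → a = 0)
    {N : Type*} [AddCommGroup N] [Module ℂ N] (σ : Representation ℂ K N) (P : V →ₗ[ℂ] N) (hP : ∀ k, ∀ v ∈ S, P (ρ k v) = σ k (P v))
    {W : Type*} [AddCommGroup W] [Module ℂ W] {τ : Representation ℂ K W} (u : τ.IntertwiningMap σ) (hu : ∀ w, u w ∈ S.map P) :
    ∃ ũ : τ.IntertwiningMap ρ, (∀ w, ũ w ∈ S) ∧ ∀ w, P (ũ w) = u w := by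
  -- `U := S ⊓ ker P` is stable; take a stable complement `C`
  have hU : ∀ k, ∀ v ∈ S ⊓ LinearMap.ker P, ρ k v ∈ S ⊓ LinearMap.ker P := fun k v hv =>
    ⟨hS k v hv.1, by
      have h0 : P v = 0 := LinearMap.mem_ker.1 hv.2
      simp only [SetLike.mem_coe, LinearMap.mem_ker, hP k v hv.1, h0, map_zero]⟩
  obtain ⟨C, hCS, hC, hdisj, hsup⟩ := exists_stable_compl_of_invariant_form ρ B hBinv hS hBdef (inf_le_left : S ⊓ LinearMap.ker P ≤ S) hU
  -- `P|_C : C → P(S)` is bijective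
  set PC : C →ₗ[ℂ] ↥(S.map P) := LinearMap.codRestrict (S.map P) (P ∘ₗ C.subtype) (fun c => ⟨c, hCS c.2, rfl⟩) with hPC
  have hPCval : ∀ c : C, ((PC c : ↥(S.map P)) : N) = P (c : V) := fun c => rfl
  have hinj : Function.Injective PC := by
    intro c c' h
    have h0 : P ((c : V) - (c' : V)) = 0 := by
      rw [map_sub, sub_eq_zero, ← hPCval, ← hPCval, h]
    have hmem : ((c : V) - (c' : V)) ∈ (S ⊓ LinearMap.ker P) ⊓ C :=
      ⟨⟨S.sub_mem (hCS c.2) (hCS c'.2), LinearMap.mem_ker.2 h0⟩, C.sub_mem c.2 c'.2⟩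
    rw [hdisj, Submodule.mem_bot, sub_eq_zero] at hmem
    exact Subtype.ext hmem
  have hsurj : Function.Surjective PC := by
    rintro ⟨_, ⟨s, hs, rfl⟩⟩
    rw [← hsup] at hs
    obtain ⟨u', hu', c, hc, rfl⟩ := Submodule.mem_sup.1 hs
    refine ⟨⟨c, hc⟩, Subtype.ext ?_⟩
    show P c = P (u' + c)
    rw [map_add, LinearMap.mem_ker.1 hu'.2, zero_add]
  set e : C ≃ₗ[ℂ] ↥(S.map P) := LinearEquiv.ofBijective PC ⟨hinj, hsurj⟩ with he
  have heval : ∀ c : C, ((e c : ↥(S.map P)) : N) = P (c : V) := fun c => rfl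
  have hesymm : ∀ x : ↥(S.map P), P ((e.symm x : C) : V) = (x : N) := fun x => by
    rw [← heval, LinearEquiv.apply_symm_apply]
  -- the lift `ũ := C.subtype ∘ e⁻¹ ∘ u`
  set L : W →ₗ[ℂ] V := C.subtype ∘ₗ (e.symm : ↥(S.map P) →ₗ[ℂ] C) ∘ₗ LinearMap.codRestrict (S.map P) u.toLinearMap hu with hL
  have hLval : ∀ w, L w = ((e.symm ⟨u w, hu w⟩ : C) : V) := fun w => rfl
  have hLeq : ∀ (k : K) (w : W), L (τ k w) = ρ k (L w) := fun k w => by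
    rw [hLval, hLval]
    -- both sides lie in `C`; compare after `e`, i.e. after `P`
    have hmem : ρ k ((e.symm ⟨u w, hu w⟩ : C) : V) ∈ C := hC k _ (e.symm ⟨u w, hu w⟩).2
    suffices h : e.symm ⟨u (τ k w), hu (τ k w)⟩ = ⟨ρ k ((e.symm ⟨u w, hu w⟩ : C) : V), hmem⟩ from congrArg Subtype.val h
    apply e.injective
    rw [LinearEquiv.apply_symm_apply]
    apply Subtype.ext
    rw [heval]
    change u (τ k w) = P (ρ k ((e.symm ⟨u w, hu w⟩ : C) : V))
    rw [hP k _ (hCS (e.symm ⟨u w, hu w⟩).2), hesymm, u.isIntertwining]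
  refine ⟨LinearMap.intertwiningMap_of_isIntertwiningMap τ ρ L hLeq, fun w => ?_, fun w => ?_⟩
  · change L w ∈ S
    rw [hLval]
    exact hCS (e.symm ⟨u w, hu w⟩).2
  · change P (L w) = u w
    rw [hLval, hesymm]

/-! ## §3 «The `τ`-part of the image lies in the image of the `τ`-part» -/

/-- **§3. THE `τ`-EXCHANGE** ([WallachRRG1] §1.4.7): in the setting of §2, every value `u w` of a `K`-map `u : τ → σ` with values in `P(S)` is `P v` for some `v ∈ S` lying in the `τ`-part of
`ρ` (★ `Representation.homRangeSum ρ τ`, indeed in the range of ONE `K`-map `τ → ρ` with values in `S`) — the converse inclusion to ★ (3′) L5 `map_chiSectionSpacePairKType_le_homRangeSum`,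
which needs the complete reducibility supplied by the invariant form. [cite: WallachRRG1, §1.4.7] [cite: BrockerTomDieck1985, II (1.9)] -/
theorem mem_map_homRangeSum_of_intertwiningMap (ρ : Representation ℂ K V)
    (B : V →ₗ⋆[ℂ] V →ₗ[ℂ] ℂ) (hBinv : ∀ (k : K) (a b : V), B (ρ k a) (ρ k b) = B a b)
    {S : Submodule ℂ V} [FiniteDimensional ℂ S] (hS : ∀ k, ∀ v ∈ S, ρ k v ∈ S) (hBdef : ∀ a ∈ S, B a a = 0 → a = 0)
    {N : Type*} [AddCommGroup N] [Module ℂ N] (σ : Representation ℂ K N) (P : V →ₗ[ℂ] N) (hP : ∀ k, ∀ v ∈ S, P (ρ k v) = σ k (P v))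
    {W : Type*} [AddCommGroup W] [Module ℂ W] {τ : Representation ℂ K W} (u : τ.IntertwiningMap σ) (hu : ∀ w, u w ∈ S.map P) (w : W) :
    u w ∈ (S ⊓ Representation.homRangeSum ρ τ).map P := by
  obtain ⟨ũ, hũS, hũP⟩ := exists_intertwiningMap_lift ρ B hBinv hS hBdef σ P hP u hu
  exact ⟨ũ w, ⟨hũS w, Representation.apply_mem_homRangeSum ũ w⟩, hũP w⟩

end Summit.HodgeConjecture.HodgeConjecture.R90.S8

end
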